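import Summits.PneNP.PneNP.Theorems.SmallBlockRothvossNetSandwich
import Literature.Barriers.PneNP.TSPExtensionComplexityRothvossKernel
import Literature.Combinatorics.Optimization.PsdFactorizationRescaling
import Literature.Combinatorics.Optimization.EquivariantPsdStructure
import HarnessLib

/-!
# Cell pnp-psdrank, T-SOC (`SmallBlockRothvoss`): block accounting — the two-block bound at Rothvoß's slot sizes

`abstract_accounting` (if `⟨W, S⟩ = 1`, `S = c·Σ_i G_i`, every piece obeys `⟨W, G_i⟩ ≤ E + η⟨K, G_i⟩ + τ ΣK`
and `⟨K, S⟩ ≤ D`, then `1 ≤ c·|ι|·(E + τ ΣK) + η D`) and `two_block_core`: for `m = 2μ+1` large and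
`n = |Slot m 72|`, every `r`-term `2 × 2`-block psd factorization of the `t`-cut slack matrix `|δ(U) ∩ M| − 1`
(`t = tCut 72 μ`) has `1 ≤ r · C0 · (t−1)² · √θ_R(m)`, `θ_R(m) = 2^{-δ_R m}`, `C0 = 32(2312π² + 1)`.
Ingredients, all in the tree: Rothvoß's all-rectangle weight datum with its dominating kernel
(`Literature.Barriers.PneNP.exists_WK_fin`), the weak Briët–Dadush–Pokutta rescaling
(`HasPsdFactorization.rescale_weak`), the square-root split of a block pairing
(`EquivariantPsdStructure.trace_mul_eq_sum_sq_sqrtRow`, `sqrtRow_sq_le_one`) and the `ε`-net sandwich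
(`netSandwich2_dominated`, file SmallBlockRothvossNetSandwich).
Source: pnp-psdrank-eng g3's farm-checked cumulative work file `HOME/pnp-psdrank-eng/lean/SocLift.lean`
(Part C, sha16 68f549726b9fc648; rc 0, 0 sorries, axioms standard), split per landing/README.md.
WHAT THIS IS NOT: a bound for general psd lifts — the block size is `2` (second-order-cone lifts), exact lifts only.
-/

set_option linter.dupNamespace false -- `Summit.PneNP.PneNP.…`: summit = sub-problem (D-0017)

noncomputable section

open scoped Classical MatrixOrder

namespace Summit.PneNP.PneNP.Theorems.SmallBlockRothvoss

open Finset Matrix Real Literature.Barriers.PneNP Literature.Combinatorics.Optimization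
  Literature.Combinatorics.Optimization.EquivariantPsdStructure

/-- **Abstract accounting**: if `⟨W, S⟩ = 1`, `S = c·Σ_i G_i` (`c ≥ 0`), every piece satisfies
`⟨W, G_i⟩ ≤ E + η⟨K, G_i⟩ + τ ΣK` (`η ≥ 0`) and `⟨K, S⟩ ≤ D`, then `1 ≤ c·|ι|·(E + τ ΣK) + η D`. -/
theorem abstract_accounting {α β ι : Type} [Fintype α] [Fintype β] [Fintype ι]
    (W K S : α → β → ℝ) (G : ι → α → β → ℝ) (c E η τ D : ℝ) (hc : 0 ≤ c) (hη : 0 ≤ η)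
    (hsum : ∑ a, ∑ b, W a b * S a b = 1)
    (hS : ∀ a b, S a b = c * ∑ i, G i a b)
    (hG : ∀ i, ∑ a, ∑ b, W a b * G i a b ≤
      E + η * ∑ a, ∑ b, K a b * G i a b + τ * ∑ a, ∑ b, K a b)
    (hKS : ∑ a, ∑ b, K a b * S a b ≤ D) :
    1 ≤ c * (Fintype.card ι * (E + τ * ∑ a, ∑ b, K a b)) + η * D := by
  have hswap : ∀ V : α → β → ℝ, ∑ a, ∑ b, V a b * S a b = c * ∑ i, ∑ a, ∑ b, V a b * G i a b := by
    intro V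
    calc ∑ a, ∑ b, V a b * S a b = ∑ a, ∑ b, ∑ i, c * (V a b * G i a b) := by
          refine sum_congr rfl fun a _ => sum_congr rfl fun b _ => ?_
          rw [hS a b, mul_sum, mul_sum]
          exact sum_congr rfl fun i _ => by ring
      _ = ∑ i, ∑ a, ∑ b, c * (V a b * G i a b) := sum_sum_sum_comm _ _ _ _
      _ = c * ∑ i, ∑ a, ∑ b, V a b * G i a b := by simp_rw [mul_sum]
  have h1 := hswap W
  have h2 := hswap K
  rw [hsum] at h1
  have h3 : c * ∑ i, ∑ a, ∑ b, W a b * G i a b ≤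
      c * ∑ i, (E + η * ∑ a, ∑ b, K a b * G i a b + τ * ∑ a, ∑ b, K a b) :=
    mul_le_mul_of_nonneg_left (sum_le_sum fun i _ => hG i) hc
  have h4 : c * ∑ i, (E + η * ∑ a, ∑ b, K a b * G i a b + τ * ∑ a, ∑ b, K a b) =
      c * (Fintype.card ι * (E + τ * ∑ a, ∑ b, K a b)) + η * (c * ∑ i, ∑ a, ∑ b, K a b * G i a b) := by
    simp only [sum_add_distrib, sum_const, card_univ, nsmul_eq_mul, ← mul_sum]
    ring
  rw [h4, ← h2] at h3
  have h5 : η * ∑ a, ∑ b, K a b * S a b ≤ η * D := mul_le_mul_of_nonneg_left hKS hη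
  linarith

/-- The constant of the two-block bound, `C0 = 32 (2312 π² + 1)`. -/
def C0 : ℝ := 32 * (2312 * π ^ 2 + 1)

/-- `C0 > 0`. -/
theorem C0_pos : 0 < C0 := by unfold C0; positivity

set_option maxHeartbeats 400000 in
/-- **The `2 × 2`-block (second-order-cone) bound at Rothvoß's slot sizes.** For `m = 2μ+1` large and
`n = |Slot m 72|`: if the `t`-cut slack matrix `|δ(U) ∩ M| − 1` of `P_PM(n)` (`t = tCut 72 μ`) is a sum of
`r` pairings of psd `2 × 2` blocks, then `1 ≤ r · C0 · (t−1)² · √θ_R(m)` with `θ_R(m) = 2^{-δ_R m}`,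
i.e. `r ≥ 2^{δ_R m/2} / (C0 (t−1)²)`. Ingredients: Rothvoß's all-rectangle weight datum with its
dominating kernel (`exists_WK_fin`), the weak Briët–Dadush–Pokutta rescaling (`rescale_weak`), the
square-root split of a block pairing (`trace_mul_eq_sum_sq`) and the `ε`-net sandwich
(`netSandwich2_dominated`). -/
theorem two_block_core (μ : ℕ) {m : ℕ} (hm : m = 2 * μ + 1)
    (hU1 : (64 / cU εR) ^ 2 ≤ (m : ℝ) + 1) (hU2 : 32 / cU εR ≤ (m : ℝ) + 1)
    (hM1 : 16 * FQ * Real.log QB / cM qR εR ≤ (m : ℝ)) {r : ℕ}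
    (A : {U : Finset (Fin (Fintype.card (Slot m qR))) // U.card = tCut qR μ} →
      Fin r → Matrix (Fin 2) (Fin 2) ℝ)
    (B : {M : Finset (Sym2 (Fin (Fintype.card (Slot m qR)))) // IsPMOn univ M} →
      Fin r → Matrix (Fin 2) (Fin 2) ℝ)
    (hA : ∀ a i, (A a i).PosSemidef) (hB : ∀ b i, (B b i).PosSemidef)
    (hfac : ∀ (a : {U : Finset (Fin (Fintype.card (Slot m qR))) // U.card = tCut qR μ})
      (b : {M : Finset (Sym2 (Fin (Fintype.card (Slot m qR)))) // IsPMOn univ M}),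
      ((b.1.filter (fun f => cutCount a.1 f = 1)).card : ℝ) - 1 = ∑ i, (A a i * B b i).trace) :
    (1 : ℝ) ≤ r * (C0 * ((tCut qR μ : ℝ) - 1) ^ 2 * Real.sqrt (θR m)) := by
  -- the weight datum
  obtain ⟨W, K, hrect, hsum, hWK, hK0, hKsum⟩ := exists_WK_fin μ hm hU1 hU2 hM1
  -- parameters
  have ht3 : 3 ≤ tCut qR μ := by unfold tCut; omega
  have hΔ2 : (2 : ℝ) ≤ (tCut qR μ : ℝ) - 1 := by
    have : (3 : ℝ) ≤ (tCut qR μ : ℝ) := by exact_mod_cast ht3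
    linarith
  generalize hΔ : ((tCut qR μ : ℝ) - 1) = Δ at hΔ2 ⊢
  have hΔ0 : 0 < Δ := by linarith
  have hθ0 : 0 < θR m := θR_pos m
  generalize hθ : θR m = θ at hrect hθ0 ⊢
  set sθ : ℝ := Real.sqrt θ with hsθ
  have hsθ0 : 0 < sθ := Real.sqrt_pos.2 hθ0
  have hsθsq : sθ * sθ = θ := Real.mul_self_sqrt hθ0.le
  set η : ℝ := 1 / (2 * Δ) with hηdef
  have hη : 0 < η := by rw [hηdef]; positivity
  have hη1 : η ≤ 1 := by
    rw [hηdef, div_le_one (by positivity)]; linarith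
  have hηΔ : η * Δ = 1 / 2 := by rw [hηdef]; field_simp
  set τ : ℝ := Δ * sθ with hτdef
  have hτ : 0 < τ := by rw [hτdef]; positivity
  -- slack
  have hSΔ : ∀ (a : {U : Finset (Fin (Fintype.card (Slot m qR))) // U.card = tCut qR μ})
      (b : {M : Finset (Sym2 (Fin (Fintype.card (Slot m qR)))) // IsPMOn univ M}),
      ((b.1.filter (fun f => cutCount a.1 f = 1)).card : ℝ) - 1 ≤ Δ := by
    intro a b
    have h1 := b.2.card_cut_le (subset_univ a.1)
    rw [a.2] at h1
    have h2 : (((b.1.filter (fun f => cutCount a.1 f = 1)).card : ℕ) : ℝ) ≤ (tCut qR μ : ℝ) := by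
      exact_mod_cast h1
    rw [← hΔ]
    linarith
  -- blocks
  set T : Fin r → {U : Finset (Fin (Fintype.card (Slot m qR))) // U.card = tCut qR μ} →
      {M : Finset (Sym2 (Fin (Fintype.card (Slot m qR)))) // IsPMOn univ M} → ℝ :=
    fun i a b => (A a i * B b i).trace with hTdef
  have hST : ∀ a b, ((b.1.filter (fun f => cutCount a.1 f = 1)).card : ℝ) - 1 = ∑ i, T i a b :=
    fun a b => hfac a b
  have hTfac : ∀ i, HasPsdFactorization (T i) 2 := fun i =>
    ⟨fun a => A a i, fun b => B b i, fun a => hA a i, fun b => hB b i, fun a b => rfl⟩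
  have hT0 : ∀ i a b, 0 ≤ T i a b := fun i a b => (hTfac i).entry_nonneg a b
  have hTΔ : ∀ i a b, T i a b ≤ Δ := by
    intro i a b
    have h1 : T i a b ≤ ∑ j, T j a b :=
      single_le_sum (f := fun j => T j a b) (fun j _ => hT0 j a b) (mem_univ i)
    linarith [hST a b, hSΔ a b]
  have hresc : ∀ i, ∃ (X : {U : Finset (Fin (Fintype.card (Slot m qR))) // U.card = tCut qR μ} →
        Matrix (Fin 2) (Fin 2) ℝ)
      (Y : {M : Finset (Sym2 (Fin (Fintype.card (Slot m qR)))) // IsPMOn univ M} →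
        Matrix (Fin 2) (Fin 2) ℝ),
      (∀ a, (X a).PosSemidef ∧ (1 - X a).PosSemidef) ∧ (∀ b, (Y b).PosSemidef ∧ (1 - Y b).PosSemidef) ∧
      ∀ a b, T i a b = ((2 : ℕ) : ℝ) ^ 2 * Δ * (X a * Y b).trace :=
    fun i => (hTfac i).rescale_weak hΔ0 (hTΔ i)
  choose X Y hX hY hTXY using hresc
  -- the rank-one-vector pieces
  set G : (Fin r × (Fin 2 × Fin 2)) →
      {U : Finset (Fin (Fintype.card (Slot m qR))) // U.card = tCut qR μ} →
      {M : Finset (Sym2 (Fin (Fintype.card (Slot m qR)))) // IsPMOn univ M} → ℝ :=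
    fun ipq a b => (sqrtRow (X ipq.1 a) ipq.2.1 ⬝ᵥ sqrtRow (Y ipq.1 b) ipq.2.2) ^ 2 with hGdef
  have hS : ∀ (a : {U : Finset (Fin (Fintype.card (Slot m qR))) // U.card = tCut qR μ})
      (b : {M : Finset (Sym2 (Fin (Fintype.card (Slot m qR)))) // IsPMOn univ M}),
      ((b.1.filter (fun f => cutCount a.1 f = 1)).card : ℝ) - 1 = (4 * Δ) * ∑ ipq, G ipq a b := by
    intro a b
    rw [hST a b, Fintype.sum_prod_type (f := fun ipq : Fin r × (Fin 2 × Fin 2) => G ipq a b),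
      mul_sum]
    refine sum_congr rfl fun i _ => ?_
    rw [hTXY i a b, trace_mul_eq_sum_sq_sqrtRow (hX i a).1 (hY i b).1,
      Fintype.sum_prod_type (f := fun pq : Fin 2 × Fin 2 => G (i, pq) a b)]
    have h4 : ((2 : ℕ) : ℝ) ^ 2 * Δ = 4 * Δ := by norm_num
    rw [h4]
  -- per-piece sandwich
  set E : ℝ := 289 * π ^ 2 * (1 * 1) ^ 2 / (η ^ 2 * τ) * (2 * θ) with hEdef
  have hpiece : ∀ ipq, ∑ a, ∑ b, W a b * G ipq a b ≤
      E + η * ∑ a, ∑ b, K a b * G ipq a b + τ * ∑ a, ∑ b, K a b := by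
    intro ipq
    exact netSandwich2_dominated W K (2 * θ) 1 1 η τ (fun a => sqrtRow (X ipq.1 a) ipq.2.1)
      (fun b => sqrtRow (Y ipq.1 b) ipq.2.2) hK0 hWK (by positivity) hη hη1 hτ one_pos one_pos
      (fun a => sqrtRow_sq_le_one (hX ipq.1 a).1 (hX ipq.1 a).2 _)
      (fun b => sqrtRow_sq_le_one (hY ipq.1 b).1 (hY ipq.1 b).2 _) hrect
  -- `⟨K, S⟩ ≤ Δ`
  have hKS : ∑ a, ∑ b, K a b * (((b.1.filter (fun f => cutCount a.1 f = 1)).card : ℝ) - 1) ≤ Δ := by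
    calc ∑ a, ∑ b, K a b * (((b.1.filter (fun f => cutCount a.1 f = 1)).card : ℝ) - 1)
        ≤ ∑ a, ∑ b, K a b * Δ :=
          sum_le_sum fun a _ => sum_le_sum fun b _ => mul_le_mul_of_nonneg_left (hSΔ a b) (hK0 a b)
      _ = (∑ a, ∑ b, K a b) * Δ := by rw [sum_mul]; simp_rw [sum_mul]
      _ ≤ 1 * Δ := mul_le_mul_of_nonneg_right hKsum hΔ0.le
      _ = Δ := one_mul Δ
  have key := abstract_accounting W K
    (fun a b => ((b.1.filter (fun f => cutCount a.1 f = 1)).card : ℝ) - 1) G (4 * Δ) E η τ Δ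
    (by positivity) hη.le hsum hS hpiece hKS
  -- arithmetic
  have hcard : (Fintype.card (Fin r × (Fin 2 × Fin 2)) : ℝ) = 4 * r := by
    simp only [Fintype.card_prod, Fintype.card_fin]; push_cast; ring
  rw [hcard, hηΔ] at key
  have hE : E = 2312 * π ^ 2 * Δ * sθ := by
    rw [hEdef, hηdef, hτdef]
    have hθ' : θ = sθ * sθ := hsθsq.symm
    rw [hθ']
    field_simp
    ring
  have hKτ : τ * ∑ a, ∑ b, K a b ≤ τ := by
    calc τ * ∑ a, ∑ b, K a b ≤ τ * 1 := mul_le_mul_of_nonneg_left hKsum hτ.le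
      _ = τ := mul_one τ
  have hr0 : (0 : ℝ) ≤ r := Nat.cast_nonneg r
  have h16 : 4 * Δ * (4 * (r : ℝ) * (E + τ * ∑ a, ∑ b, K a b)) ≤ 16 * r * Δ * (E + τ) := by
    have h' : 0 ≤ 4 * Δ * (4 * (r : ℝ)) := by positivity
    have := mul_le_mul_of_nonneg_left (show E + τ * ∑ a, ∑ b, K a b ≤ E + τ by linarith) h'
    linarith [this]
  have hmain : (1 : ℝ) ≤ 32 * r * Δ * (E + τ) := by linarith
  rw [hE, hτdef] at hmain
  have hfin : 32 * (r : ℝ) * Δ * (2312 * π ^ 2 * Δ * sθ + Δ * sθ) = r * (C0 * Δ ^ 2 * sθ) := by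
    unfold C0; ring
  linarith [hfin]

end Summit.PneNP.PneNP.Theorems.SmallBlockRothvoss

end
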